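import Mathlib.Analysis.Calculus.IteratedDeriv.Lemmas
import Literature.Analysis.FunctionSpaces.TorusShearKoopman

/-!
# K1loc, line `Spectral` / SeqCone — helper: ITERATED DERIVATIVES OF A CUT-OFF TIMES A PHASE FLAT ON ITS SUPPORT (B3b)

Helper file of the prover lane on the crux `K1LocalisedCascade` (stmt-AnomalousDissipation-19491), route
`SawtoothPulseCascade` (NOTES HANDOFF B3b).  The un-gauging multipliers of the cascade are `Θ(y) = X(y)·φ(y)` with a
smooth cut-off `X` supported inside an open set `U` (the flat strips) on which the phase `φ = g_n e_b` satisfies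
`φ' = c φ` with the CONSTANT `c = −2πiβ` (`|β| ≤ 1/2`).  Then all derivatives stay of the same form:
`(Xφ)^{(α)} = p_α φ` with `p_0 = X`, `p_{α+1} = p_α' + c p_α` — smooth, supported inside `U` — so that the derivative
multipliers of `…SlotExpansion` are explicit, bounded by `Σ_i C(α,i)|c|^i ‖X^{(α−i)}‖_∞` WITHOUT any factor from the
oscillation `n` of the phase, and supported where `X` is (disjointness from the other strip family).
Result: `iteratedDeriv_mul_eq_of_flat` (with the smoothness and support of the `p_α`), `hasDerivAt_iteratedDeriv_mul`.
No definitions (the sequence `p` is an input with its recursion as hypotheses); no statement about the stub.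
[cite: Grafakos2014, Prop. 3.1.2 (5)] [problem: turb]
-/

-- `Summit.<Summit>.<Problem>`: single-conjunct summit, the duplicate namespace segment is deliberate.
set_option linter.dupNamespace false

noncomputable section

namespace Summit.AnomalousDissipation.AnomalousDissipation.Theorems.SawtoothPulseCascade.K1Slot

open Set Filter Topology
open scoped ContDiff

/-- **Leibniz on the flat set.**  `X` smooth with `X = 0` near every point outside the open set `U`; `φ` with
`φ' = c φ` on `U`; `p_0 = X`, `p_{α+1} = p_α' + c p_α`.  Then for every `α`:
`(X φ)^{(α)} = p_α φ`, `p_α` is smooth, and `p_α = 0` near every point outside `U`. [cite: Grafakos2014, Prop. 3.1.2 (5)] -/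
theorem iteratedDeriv_mul_eq_of_flat {X φ : ℝ → ℂ} {c : ℂ} {U : Set ℝ} (hX : ContDiff ℝ ∞ X)
    (hXU : ∀ y, y ∉ U → X =ᶠ[𝓝 y] 0) (hφ : ∀ y ∈ U, HasDerivAt φ (c * φ y) y) {p : ℕ → ℝ → ℂ} (hp0 : p 0 = X)
    (hps : ∀ α, p (α + 1) = fun y => deriv (p α) y + c * p α y) (α : ℕ) :
    iteratedDeriv α (fun y => X y * φ y) = (fun y => p α y * φ y) ∧ ContDiff ℝ ∞ (p α) ∧
      ∀ y, y ∉ U → p α =ᶠ[𝓝 y] 0 := by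
  induction α with
  | zero =>
    refine ⟨?_, by rw [hp0]; exact hX, fun y hy => by rw [hp0]; exact hXU y hy⟩
    rw [iteratedDeriv_zero, hp0]
  | succ α ih =>
    obtain ⟨ih1, ih2, ih3⟩ := ih
    have hpd : ∀ y, HasDerivAt (p α) (deriv (p α) y) y := fun y =>
      ((ih2.differentiable (by simp)).differentiableAt).hasDerivAt
    -- support of `p_{α+1}`
    have hder0 : ∀ y, y ∉ U → deriv (p α) =ᶠ[𝓝 y] 0 := by
      intro y hy
      have h := (ih3 y hy).eventually_nhds
      filter_upwards [h] with z hz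
      have hz' : p α =ᶠ[𝓝 z] (fun _ => (0 : ℂ)) := hz
      rw [hz'.deriv_eq, Pi.zero_apply, deriv_const]
    have hsupp : ∀ y, y ∉ U → p (α + 1) =ᶠ[𝓝 y] 0 := by
      intro y hy
      rw [hps α]
      filter_upwards [ih3 y hy, hder0 y hy] with z hz hz'
      rw [hz, hz', Pi.zero_apply, mul_zero, add_zero]
    refine ⟨?_, ?_, hsupp⟩
    · rw [iteratedDeriv_succ, ih1]
      funext y
      by_cases hy : y ∈ U
      · have hprod : HasDerivAt (fun y => p α y * φ y) (deriv (p α) y * φ y + p α y * (c * φ y)) y :=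
          (hpd y).mul (hφ y hy)
        rw [hprod.deriv, hps α]
        ring
      · have h0 : (fun y => p α y * φ y) =ᶠ[𝓝 y] (fun _ => (0 : ℂ)) := by
          filter_upwards [ih3 y hy] with z hz
          rw [hz, Pi.zero_apply, zero_mul]
        rw [h0.deriv_eq, deriv_const, hps α]
        simp only
        rw [(hder0 y hy).eq_of_nhds, (ih3 y hy).eq_of_nhds, Pi.zero_apply, mul_zero, add_zero, zero_mul]
    · rw [hps α]
      exact (ih2.iterate_deriv 1).add (contDiff_const.mul ih2)

/-- **The family `f_α = (Xφ)^{(α)}` is a derivative chain**: `f_α' = f_{α+1}` everywhere, when `X, φ` are smooth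
(the hypothesis of `…SlotAxisDeriv.mFourierCoeff_comp_eval_periodicLift_iterate`). [folklore] -/
theorem hasDerivAt_iteratedDeriv_mul {X φ : ℝ → ℂ} (hX : ContDiff ℝ ∞ X) (hφ : ContDiff ℝ ∞ φ) (α : ℕ) (y : ℝ) :
    HasDerivAt (iteratedDeriv α (fun y => X y * φ y)) (iteratedDeriv (α + 1) (fun y => X y * φ y) y) y := by
  have hF : ContDiff ℝ ∞ (fun y => X y * φ y) := hX.mul hφ
  have hd : ContDiff ℝ ∞ (iteratedDeriv α (fun y => X y * φ y)) := by
    rw [iteratedDeriv_eq_iterate]; exact hF.iterate_deriv α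
  rw [iteratedDeriv_succ]
  exact ((hd.differentiable (by simp)).differentiableAt).hasDerivAt

/-- Periodicity is inherited by all derivatives `(Xφ)^{(α)}` of a periodic product. [folklore] -/
theorem periodic_iteratedDeriv {F : ℝ → ℂ} {T : ℝ} (hF : Function.Periodic F T) (α : ℕ) :
    Function.Periodic (iteratedDeriv α F) T := by
  induction α with
  | zero => rwa [iteratedDeriv_zero]
  | succ α ih =>
    intro y
    rw [iteratedDeriv_succ]
    have h : iteratedDeriv α F = fun z => iteratedDeriv α F (z + T) := funext fun z => (ih z).symm
    conv_rhs => rw [h]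
    rw [deriv_comp_add_const]

/-- Sup bound of the recursion: if `‖p_α‖ ≤ A` and `‖p_α'‖ ≤ D` then `‖p_{α+1}‖ ≤ D + ‖c‖ A`. [folklore] -/
theorem norm_succ_le_of_flat {p : ℕ → ℝ → ℂ} {c : ℂ} (hps : ∀ α, p (α + 1) = fun y => deriv (p α) y + c * p α y)
    (α : ℕ) {A D : ℝ} (hA : ∀ y, ‖p α y‖ ≤ A) (hD : ∀ y, ‖deriv (p α) y‖ ≤ D) (y : ℝ) :
    ‖p (α + 1) y‖ ≤ D + ‖c‖ * A := by
  rw [hps α]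
  calc ‖deriv (p α) y + c * p α y‖ ≤ ‖deriv (p α) y‖ + ‖c * p α y‖ := norm_add_le _ _
    _ ≤ D + ‖c‖ * A := by rw [norm_mul]; exact add_le_add (hD y) (mul_le_mul_of_nonneg_left (hA y) (norm_nonneg _))

/-- Disjointness is inherited: if `X⁻ = 0` on `U` then `conj(p_α y φ y) · (X⁻ y ψ y) = 0` for all `y`. [folklore] -/
theorem conj_mul_eq_zero_of_flat {X φ : ℝ → ℂ} {c : ℂ} {U : Set ℝ} (hX : ContDiff ℝ ∞ X)
    (hXU : ∀ y, y ∉ U → X =ᶠ[𝓝 y] 0) (hφ : ∀ y ∈ U, HasDerivAt φ (c * φ y) y) {p : ℕ → ℝ → ℂ} (hp0 : p 0 = X)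
    (hps : ∀ α, p (α + 1) = fun y => deriv (p α) y + c * p α y) {Xm ψ : ℝ → ℂ} (hXm : ∀ y ∈ U, Xm y = 0)
    (α : ℕ) (y : ℝ) : (starRingEnd ℂ) (p α y * φ y) * (Xm y * ψ y) = 0 := by
  by_cases hy : y ∈ U
  · rw [hXm y hy, zero_mul, mul_zero]
  · obtain ⟨_, _, h3⟩ := iteratedDeriv_mul_eq_of_flat hX hXU hφ hp0 hps α
    rw [(h3 y hy).eq_of_nhds, Pi.zero_apply, zero_mul, map_zero, zero_mul]

end Summit.AnomalousDissipation.AnomalousDissipation.Theorems.SawtoothPulseCascade.K1Slot
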